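import Summits.BirchSwinnertonDyer.BirchSwinnertonDyer.Theorems.KimAtThreeShallowEqDeepStubOfPorts
import Summits.BirchSwinnertonDyer.BirchSwinnertonDyer.Theorems.KimAtThreeDeepUpperOfPortsClasswide
import HarnessLib

/-!
# Route `KimAtThreeKolyvagin` (rung W2): cruxes `DeepUpperAtThree` (19076) and `ShallowEqDeepAtTorsionFree`
# (19077) on the Kato stratum, CLASS-WIDE, GRANTED [S24] (1)(2), GZK, Poitou–Tate (all PUB) and ONE
# dictionary port — NO inline port

Cell `bsd-addord`, seat `bsd-addord-w2-c4` (D-0074 row B7), gen 4; sequel of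
`KimAtThreeShallowEqDeepStubOfPorts` (`deepUpper_conclusion_of_ports_noStub`).  Theorems only (no
definition, no named fact, no `sorry`); cruxes 19076/19077 stay OPEN; nothing asserted about any curve.
These are w2-c3's `KimAtThreeDeepUpperOfPortsOptimal` / `…Classwide` wrappers and kim3's
`shallowEqDeep_conclusion_[classwide_]of_ports_of_deepUpper` with the STUB binder `hStub` REMOVED (it is now
the theorem `KimAtThreeShallowEqDeepStubOfWitnesses.exists_eq_nsmul_add_of_witnesses`):
* `deepUpper_datum_of_ports_noStub` — the row in the crux's currency (`ord(δ̃) = 0`);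
* `deepUpper_optimal_of_ports_noStub` — the period transfer discharged by optimality
  (`X4.periodTransfer_of_optimal`);
* `deepUpper_optimal_of_poitouTate_noStub` — the Poitou–Tate binders supplied by the named fact
  `poitouTate_selmerStructure_duality ℚ`;
* **`deepUpper_conclusion_classwide_noStub`** — crux 19076's conclusion AT ANY globally minimal `W`
  `ℚ`-isogenous to an optimal `W₀` of the Kato stratum (`3 ∤ c₃(W₀)`, optimal datum `D₀` with `3 ∤ c_{D₀}`,
  port at `(v₃, η, D₀)`), with the tower onto, additive `3`, `E(ℚ₃)[3] = 0`, `3`-integral plus symbols and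
  `ord(δ̃) = 0` for `D₀.f`;
* **`shallowEqDeep_conclusion_of_ports_noStub`**, **`shallowEqDeep_conclusion_classwide_noStub`** — crux
  19077's conclusion `∂^{(∞)}_deep(δ̃) ≤ ∂^{(∞)}(δ̃)` on the same rows from the SAME inputs (kim3's
  `shallowEqDeep_conclusion_[classwide_]of_ports_of_deepUpper`, its hypothesis `hU` = 19076 at `W` produced).
GRANTED, and nothing else: `hS24`/`hS24₂` (PUB), GZK (PUB), `poitouTate_selmerStructure_duality ℚ` (PUB),
ONE port `KatoKuriharaPortThreeAtWith₂ W₀ 0 v₃ η D₀` (FLAG `K22-Thm3.13-PORT@3`), and Carayol's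
level = conductor as the binder `hN` where kim3's lemma wants it.  NOT COVERED: `3 ∣ c₃`, `t ≥ 1`,
non-additive `3` (the cruxes quantify over them; these rows are other files' business).
[cite: Kim2025RefinedTNC, Thm 1.1, §5] [cite: Kim2022StructureSelmer, Thm. 1.9 (6) and Thm. 3.13]
[cite: MazurRubin2004, Thm. 4.4.1 and Cor. 4.1.9] [cite: Sakamoto2024, Thm. 4.4 (1)(2) (p. 926)]
[cite: MilneADT2006, Ch. I, Thm. 4.10] [cite: SilvermanAEC2009, Cor. III.4.11] [cite: CremonaAlgorithms1997, §2.8 (p. 26)]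
-/

set_option autoImplicit false
-- the Theorems namespace of a single-conjunct summit repeats the summit name by design (D-0017)
set_option linter.dupNamespace false

noncomputable section

open scoped Classical NumberField
open Function Field NumberField IsDedekindDomain WeierstrassCurve CongruenceSubgroup
  Literature.NumberTheory.EllipticCurves Literature.NumberTheory.EllipticCurves.ModularForms
  Literature.NumberTheory.EllipticCurves.Rank1Residual
  Literature.NumberTheory.GaloisRepresentations Literature.NumberTheory.GaloisCohomology
  Summit.BirchSwinnertonDyer.Rank1Residual.GaloisImage Summit.BirchSwinnertonDyer.Rank1Residual.X4
  Summit.BirchSwinnertonDyer.BirchSwinnertonDyer.Theorems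
  Summit.BirchSwinnertonDyer.BirchSwinnertonDyer.Theorems.KimAtThreeKolyvaginUnitLevelOneRungs
  Summit.BirchSwinnertonDyer.BirchSwinnertonDyer.Theorems.KimAtThreeKolyvaginIsogenyInvariance
  Summit.BirchSwinnertonDyer.BirchSwinnertonDyer.Theorems.KimAtThreeKolyvaginIsogenyTransport
  Summit.BirchSwinnertonDyer.BirchSwinnertonDyer.Theorems.KimAtThreeKolyvaginIsogenyCruxes
  Summit.BirchSwinnertonDyer.BirchSwinnertonDyer.Theorems.KimAtThreeDeepLowerKatoStratumOfFacts
  Summit.BirchSwinnertonDyer.BirchSwinnertonDyer.Theorems.KimAtThreeKolyvaginDeepLowerKatoStratumShallow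
  Summit.BirchSwinnertonDyer.BirchSwinnertonDyer.Theorems.KimAtThreeKolyvaginIsogenyKatoStratum
  Summit.BirchSwinnertonDyer.BirchSwinnertonDyer.Theorems.KimAtThreeDeepUpperOfPortsClasswide
  Summit.BirchSwinnertonDyer.BirchSwinnertonDyer.Theorems.KimAtThreeShallowEqDeepStubOfPorts

namespace Summit.BirchSwinnertonDyer.BirchSwinnertonDyer.Theorems.KimAtThreeShallowEqDeepNoStubCruxes

/-! ## §6a. Crux 19076 at a row: the crux's currency, optimality, the Poitou–Tate named fact -/

/-- **Crux 19076 at a row of the Kato stratum from the ports, in the crux's currency, NO inline port**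
(`ord(δ̃) = 0` instead of `L(E,1) ≠ 0`). [cite: Kim2025RefinedTNC, Thm 1.1, §5]
[cite: MazurRubin2004, Thm. 4.4.1 and Cor. 4.1.9] -/
theorem deepUpper_datum_of_ports_noStub
    (hS24 : Sakamoto2024.kolyvaginSystems_freeRankOne_zmod_three_pow)
    (hS24₂ : Sakamoto2024.kolyvaginSystems_idealOfBasis_eq_fittingIdeal_zmod_three_pow)
    (hGZK : rank_eq_analyticRank_of_analyticRank_le_one)
    (W : WeierstrassCurve ℚ) [W.IsElliptic] [W.IsGloballyMinimal]
    (hadd : haveI : Fact (Nat.Prime 3) := ⟨Nat.prime_three⟩; Addv W 3)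
    (hc3 : ¬ 3 ∣ (W.baseChange ℚ_[3]).localTamagawaNumber ℤ_[3])
    (htower : ∀ m : ℕ, W.HasSurjectiveModNGaloisRep (3 ^ m : ℕ))
    (ht0 : Nat.card {Q : (W.baseChange ℚ_[3]).toAffine.Point // (3 : ℕ) • Q = 0} = 1)
    {N : ℕ} [NeZero N] (D : ModularParametrizationData W N) (hcD : ¬ (3 : ℤ) ∣ D.maninConstant)
    (hper : ∃ u : ℚ, ‖(u : ℚ_[3])‖ = 1 ∧ W.realPeriodRat = u * plusPeriod D.f)
    (hint : ∀ r : ℚ, ratPlusSymbol D.f r ≠ 0 → 0 ≤ padicValRat 3 (ratPlusSymbol D.f r))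
    (hord : kuriharaVanishingOrder W 3 D.f = 0)
    (inv : LocalInvariants ℚ 3) (hperf : inv.IsPerfect) (hsum : inv.SumLocalTermEqZero)
    (hcompl : inv.SelmerComplement)
    (inv' : ∀ k' : ℕ, LocalInvariants ℚ (3 ^ (k' + 1))) (hperf' : ∀ k', (inv' k').IsPerfect)
    (hsum' : ∀ k', (inv' k').SumLocalTermEqZero) (hcompl' : ∀ k', (inv' k').SelmerComplement)
    (hinj' : ∀ k', ∀ v : HeightOneSpectrum (𝓞 ℚ), Injective (inv' k' (Sum.inr v)))
    (v₃ : HeightOneSpectrum (𝓞 ℚ)) (hv₃ : ((3 : ℕ) : 𝓞 ℚ) ∈ v₃.asIdeal)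
    (η : (q : HeightOneSpectrum (𝓞 ℚ)) → (ZMod (Ideal.absNorm q.asIdeal))ˣ)
    (hη : ∀ q : HeightOneSpectrum (𝓞 ℚ), Subgroup.zpowers (η q) = ⊤)
    (hPort : KatoKuriharaPortThreeAtWith₂ W 0 v₃ η D) :
    ∃ dd : ℕ, kuriharaPartialDeepInfty W 3 D.f = dd ∧
      ((padicValNat 3 (Nat.card (AddCommGroup.primaryComponent W.sha 3)) + dd : ℕ) : ℕ∞) ≤
        kuriharaPartial W 3 D.f 0 := by
  haveI : Fact (Nat.Prime 3) := ⟨Nat.prime_three⟩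
  have h0 : ratPlusSymbol D.f 0 ≠ 0 :=
    ratPlusSymbol_zero_ne_zero_of_kuriharaVanishingOrder_eq_zero W 3 D.f hord
  have hL : W.entireLFunction 1 ≠ 0 :=
    D.isNewformOf.entireLFunction_one_ne_zero_of_ratPlusSymbol_zero_ne_zero h0
  exact deepUpper_conclusion_of_ports_noStub hS24 hS24₂ hGZK W hadd hc3 htower ht0 hL D hcD hper hint inv
    hperf hsum hcompl inv' hperf' hsum' hcompl' hinj' v₃ hv₃ η hη hPort

/-- **The same with the period transfer DISCHARGED by optimality** (`X4.periodTransfer_of_optimal`): GRANTED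
the inputs, crux `DeepUpperAtThree` holds for the newform of every optimal datum on the stratum {tower,
additive `3`, `3 ∤ c₃`, `E(ℚ₃)[3] = 0`, `3 ∤ c_D`} — NO inline port.
[cite: Kim2025RefinedTNC, Thm 1.1] [cite: CremonaAlgorithms1997, §2.8 (p. 26)] -/
theorem deepUpper_optimal_of_ports_noStub
    (hS24 : Sakamoto2024.kolyvaginSystems_freeRankOne_zmod_three_pow)
    (hS24₂ : Sakamoto2024.kolyvaginSystems_idealOfBasis_eq_fittingIdeal_zmod_three_pow)
    (hGZK : rank_eq_analyticRank_of_analyticRank_le_one)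
    (W : WeierstrassCurve ℚ) [W.IsElliptic] [W.IsGloballyMinimal]
    (hadd : haveI : Fact (Nat.Prime 3) := ⟨Nat.prime_three⟩; Addv W 3)
    (hc3 : ¬ 3 ∣ (W.baseChange ℚ_[3]).localTamagawaNumber ℤ_[3])
    (htower : ∀ m : ℕ, W.HasSurjectiveModNGaloisRep (3 ^ m : ℕ))
    (ht0 : Nat.card {Q : (W.baseChange ℚ_[3]).toAffine.Point // (3 : ℕ) • Q = 0} = 1)
    {N : ℕ} [NeZero N] (D : ModularParametrizationData W N)
    (hopt : ∀ z ∈ D.L.lattice, ∃ w ∈ periodLattice D.f, z = D.c * w)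
    (hcD : ¬ (3 : ℤ) ∣ D.maninConstant)
    (hint : ∀ r : ℚ, ratPlusSymbol D.f r ≠ 0 → 0 ≤ padicValRat 3 (ratPlusSymbol D.f r))
    (hord : kuriharaVanishingOrder W 3 D.f = 0)
    (inv : LocalInvariants ℚ 3) (hperf : inv.IsPerfect) (hsum : inv.SumLocalTermEqZero)
    (hcompl : inv.SelmerComplement)
    (inv' : ∀ k' : ℕ, LocalInvariants ℚ (3 ^ (k' + 1))) (hperf' : ∀ k', (inv' k').IsPerfect)
    (hsum' : ∀ k', (inv' k').SumLocalTermEqZero) (hcompl' : ∀ k', (inv' k').SelmerComplement)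
    (hinj' : ∀ k', ∀ v : HeightOneSpectrum (𝓞 ℚ), Injective (inv' k' (Sum.inr v)))
    (v₃ : HeightOneSpectrum (𝓞 ℚ)) (hv₃ : ((3 : ℕ) : 𝓞 ℚ) ∈ v₃.asIdeal)
    (η : (q : HeightOneSpectrum (𝓞 ℚ)) → (ZMod (Ideal.absNorm q.asIdeal))ˣ)
    (hη : ∀ q : HeightOneSpectrum (𝓞 ℚ), Subgroup.zpowers (η q) = ⊤)
    (hPort : KatoKuriharaPortThreeAtWith₂ W 0 v₃ η D) :
    ∃ dd : ℕ, kuriharaPartialDeepInfty W 3 D.f = dd ∧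
      ((padicValNat 3 (Nat.card (AddCommGroup.primaryComponent W.sha 3)) + dd : ℕ) : ℕ∞) ≤
        kuriharaPartial W 3 D.f 0 :=
  haveI : Fact (Nat.Prime 3) := ⟨Nat.prime_three⟩
  deepUpper_datum_of_ports_noStub hS24 hS24₂ hGZK W hadd hc3 htower ht0 D hcD
    (periodTransfer_of_optimal 3 D hopt hcD) hint hord inv hperf hsum hcompl inv' hperf' hsum' hcompl' hinj'
    v₃ hv₃ η hη hPort

/-- **Crux 19076 at an OPTIMAL datum of the Kato stratum, GRANTED three named published facts and ONE
port — NO inline port**: the Poitou–Tate binders supplied by `poitouTate_selmerStructure_duality ℚ`.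
[cite: Kim2025RefinedTNC, Thm 1.1] [cite: MilneADT2006, Ch. I, Thm. 4.10] -/
theorem deepUpper_optimal_of_poitouTate_noStub
    (hS24 : Sakamoto2024.kolyvaginSystems_freeRankOne_zmod_three_pow)
    (hS24₂ : Sakamoto2024.kolyvaginSystems_idealOfBasis_eq_fittingIdeal_zmod_three_pow)
    (hGZK : rank_eq_analyticRank_of_analyticRank_le_one)
    (hPT : poitouTate_selmerStructure_duality ℚ)
    (W : WeierstrassCurve ℚ) [W.IsElliptic] [W.IsGloballyMinimal]
    (hadd : haveI : Fact (Nat.Prime 3) := ⟨Nat.prime_three⟩; Addv W 3)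
    (hc3 : ¬ 3 ∣ (W.baseChange ℚ_[3]).localTamagawaNumber ℤ_[3])
    (htower : ∀ m : ℕ, W.HasSurjectiveModNGaloisRep (3 ^ m : ℕ))
    (ht0 : Nat.card {Q : (W.baseChange ℚ_[3]).toAffine.Point // (3 : ℕ) • Q = 0} = 1)
    {N : ℕ} [NeZero N] (D : ModularParametrizationData W N)
    (hopt : ∀ z ∈ D.L.lattice, ∃ w ∈ periodLattice D.f, z = D.c * w)
    (hcD : ¬ (3 : ℤ) ∣ D.maninConstant)
    (hint : ∀ r : ℚ, ratPlusSymbol D.f r ≠ 0 → 0 ≤ padicValRat 3 (ratPlusSymbol D.f r))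
    (hord : kuriharaVanishingOrder W 3 D.f = 0)
    (v₃ : HeightOneSpectrum (𝓞 ℚ)) (hv₃ : ((3 : ℕ) : 𝓞 ℚ) ∈ v₃.asIdeal)
    (η : (q : HeightOneSpectrum (𝓞 ℚ)) → (ZMod (Ideal.absNorm q.asIdeal))ˣ)
    (hη : ∀ q : HeightOneSpectrum (𝓞 ℚ), Subgroup.zpowers (η q) = ⊤)
    (hPort : KatoKuriharaPortThreeAtWith₂ W 0 v₃ η D) :
    ∃ dd : ℕ, kuriharaPartialDeepInfty W 3 D.f = dd ∧
      ((padicValNat 3 (Nat.card (AddCommGroup.primaryComponent W.sha 3)) + dd : ℕ) : ℕ∞) ≤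
        kuriharaPartial W 3 D.f 0 := by
  haveI : Fact (Nat.Prime 3) := ⟨Nat.prime_three⟩
  obtain ⟨inv, hperf, hsum, -, hcompl⟩ := hPT 3
  obtain ⟨inv', hperf', hsum', hcompl', hinj'⟩ := exists_localInvariants_three_pow_of_poitouTate hPT
  exact deepUpper_optimal_of_ports_noStub hS24 hS24₂ hGZK W hadd hc3 htower ht0 D hopt hcD hint hord
    inv hperf hsum hcompl inv' hperf' hsum' hcompl' hinj' v₃ hv₃ η hη hPort

/-! ## §6b. Cruxes 19076 and 19077 on the Kato stratum, class-wide along prime-to-`3` isogenies -/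

/-- **Crux 19076 (`DeepUpperAtThree`) on the Kato stratum, CLASS-WIDE, NO inline port.**  `W₀` globally
minimal carrying an OPTIMAL datum `D₀` with `3 ∤ c_{D₀}`, `3 ∤ c₃(W₀)` and the dictionary port PORT″ at
`(v₃, η, D₀)`; `W` ANY globally minimal curve `ℚ`-isogenous to `W₀` with the `3`-adic tower onto, additive
at `3`, `E(ℚ₃)[3] = 0`, `3`-integral plus symbols and `ord(δ̃) = 0` for `D₀.f`.  Then, GRANTED [S24]
(1)(2), GZK and Poitou–Tate: `∂^{(∞)}_deep = d ∈ ℕ` and `ord₃ #Ш(W)(3) + d ≤ ∂⁽⁰⁾` AT `W`.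
[cite: Kim2025RefinedTNC, Thm 1.1] [cite: Sakamoto2024, Thm. 4.4 (p. 926)] [cite: MilneADT2006, Ch. I, Thm. 4.10]
[cite: SilvermanAEC2009, Cor. III.4.11] -/
theorem deepUpper_conclusion_classwide_noStub
    (hS24 : Sakamoto2024.kolyvaginSystems_freeRankOne_zmod_three_pow)
    (hS24₂ : Sakamoto2024.kolyvaginSystems_idealOfBasis_eq_fittingIdeal_zmod_three_pow)
    (hGZK : rank_eq_analyticRank_of_analyticRank_le_one)
    (hPT : poitouTate_selmerStructure_duality ℚ)
    (W W₀ : WeierstrassCurve ℚ) [W.IsElliptic] [W.IsGloballyMinimal] [W₀.IsElliptic]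
    [W₀.IsGloballyMinimal] (hiso : IsIsogenous W W₀)
    (hadd : haveI : Fact (Nat.Prime 3) := ⟨Nat.prime_three⟩; Addv W 3)
    (htower : ∀ m : ℕ, W.HasSurjectiveModNGaloisRep (3 ^ m : ℕ))
    (ht0 : Nat.card {Q : (W.baseChange ℚ_[3]).toAffine.Point // (3 : ℕ) • Q = 0} = 1)
    (hc3 : ¬ 3 ∣ (W₀.baseChange ℚ_[3]).localTamagawaNumber ℤ_[3])
    {N : ℕ} [NeZero N] (D₀ : ModularParametrizationData W₀ N)
    (hopt : ∀ z ∈ D₀.L.lattice, ∃ w ∈ periodLattice D₀.f, z = D₀.c * w)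
    (hcD : ¬ (3 : ℤ) ∣ D₀.maninConstant)
    (hint : ∀ r : ℚ, ratPlusSymbol D₀.f r ≠ 0 → 0 ≤ padicValRat 3 (ratPlusSymbol D₀.f r))
    (v₃ : HeightOneSpectrum (𝓞 ℚ)) (hv₃ : ((3 : ℕ) : 𝓞 ℚ) ∈ v₃.asIdeal)
    (η : (q : HeightOneSpectrum (𝓞 ℚ)) → (ZMod (Ideal.absNorm q.asIdeal))ˣ)
    (hη : ∀ q : HeightOneSpectrum (𝓞 ℚ), Subgroup.zpowers (η q) = ⊤)
    (hPort : KatoKuriharaPortThreeAtWith₂ W₀ 0 v₃ η D₀)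
    (hord : kuriharaVanishingOrder W 3 D₀.f = 0) :
    ∃ dd : ℕ, kuriharaPartialDeepInfty W 3 D₀.f = dd ∧
      ((padicValNat 3 (Nat.card (AddCommGroup.primaryComponent W.sha 3)) + dd : ℕ) : ℕ∞) ≤
        kuriharaPartial W 3 D₀.f 0 := by
  haveI : Fact (Nat.Prime 3) := ⟨Nat.prime_three⟩
  have hirr : W.HasIrreducibleModPGaloisRep 3 := hasIrreducibleModPGaloisRep_of_tower htower
  have h₀ := deepUpper_optimal_of_poitouTate_noStub hS24 hS24₂ hGZK hPT W₀
    ((addv_iff_of_isIsogenous hiso).mp hadd) hc3 (towerSurjective_of_isIsogenous hiso htower)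
    (by rw [← natCard_torsion_padic_eq_of_isIsogenous hiso hirr]; exact ht0) D₀ hopt hcD hint
    (by rw [← kuriharaVanishingOrder_eq_of_isIsogenous D₀.f hiso hirr]; exact hord) v₃ hv₃ η hη hPort
  exact (deepUpper_conclusion_iff_of_isIsogenous D₀.f hiso hirr).mpr h₀

/-- **Crux 19077 (`ShallowEqDeepAtTorsionFree`) at a row of the Kato stratum from the ports, NO inline
port**: kim3's `shallowEqDeep_conclusion_of_ports_of_deepUpper` with its hypothesis `hU` (crux 19076 at the
row) PRODUCED by `deepUpper_datum_of_ports_noStub`: `∂^{(∞)}_deep(δ̃) ≤ ∂^{(∞)}(δ̃)` for `(W, D.f)`, datum at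
the conductor. [cite: Kim2025RefinedTNC, Thm 1.1] [cite: MazurRubin2004, Thm. 5.2.12 (i)]
[cite: Sakamoto2024, Thm. 4.4 (p. 926)] -/
theorem shallowEqDeep_conclusion_of_ports_noStub
    (hS24 : Sakamoto2024.kolyvaginSystems_freeRankOne_zmod_three_pow)
    (hS24₂ : Sakamoto2024.kolyvaginSystems_idealOfBasis_eq_fittingIdeal_zmod_three_pow)
    (hGZK : rank_eq_analyticRank_of_analyticRank_le_one)
    (W : WeierstrassCurve ℚ) [W.IsElliptic] [W.IsGloballyMinimal]
    (hadd : haveI : Fact (Nat.Prime 3) := ⟨Nat.prime_three⟩; Addv W 3)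
    (hc3 : ¬ 3 ∣ (W.baseChange ℚ_[3]).localTamagawaNumber ℤ_[3])
    (htower : ∀ m : ℕ, W.HasSurjectiveModNGaloisRep (3 ^ m : ℕ))
    (ht0 : Nat.card {Q : (W.baseChange ℚ_[3]).toAffine.Point // (3 : ℕ) • Q = 0} = 1)
    {N : ℕ} [NeZero N] (hN : N = W.conductorNorm ℤ) (D : ModularParametrizationData W N)
    (hcD : ¬ (3 : ℤ) ∣ D.maninConstant)
    (hper : ∃ u : ℚ, ‖(u : ℚ_[3])‖ = 1 ∧ W.realPeriodRat = u * plusPeriod D.f)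
    (hint : ∀ r : ℚ, ratPlusSymbol D.f r ≠ 0 → 0 ≤ padicValRat 3 (ratPlusSymbol D.f r))
    (inv : LocalInvariants ℚ 3) (hperf : inv.IsPerfect) (hsum : inv.SumLocalTermEqZero)
    (hcompl : inv.SelmerComplement)
    (inv' : ∀ k' : ℕ, LocalInvariants ℚ (3 ^ (k' + 1))) (hperf' : ∀ k', (inv' k').IsPerfect)
    (hsum' : ∀ k', (inv' k').SumLocalTermEqZero) (hcompl' : ∀ k', (inv' k').SelmerComplement)
    (hinj' : ∀ k', ∀ v : HeightOneSpectrum (𝓞 ℚ), Injective (inv' k' (Sum.inr v)))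
    (v₃ : HeightOneSpectrum (𝓞 ℚ)) (hv₃ : ((3 : ℕ) : 𝓞 ℚ) ∈ v₃.asIdeal)
    (η : (q : HeightOneSpectrum (𝓞 ℚ)) → (ZMod (Ideal.absNorm q.asIdeal))ˣ)
    (hη : ∀ q : HeightOneSpectrum (𝓞 ℚ), Subgroup.zpowers (η q) = ⊤)
    (hPort : KatoKuriharaPortThreeAtWith₂ W 0 v₃ η D)
    (hord : kuriharaVanishingOrder W 3 D.f = 0) :
    kuriharaPartialDeepInfty W 3 D.f ≤ kuriharaPartialInfty W 3 D.f :=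
  shallowEqDeep_conclusion_of_ports_of_deepUpper hS24 hS24₂ hGZK W hadd hc3 htower ht0 hN D hcD hper inv hperf
    hsum hcompl inv' hperf' hsum' hcompl' hinj' v₃ hv₃ η hη hPort hord
    (deepUpper_datum_of_ports_noStub hS24 hS24₂ hGZK W hadd hc3 htower ht0 D hcD hper hint hord inv hperf
      hsum hcompl inv' hperf' hsum' hcompl' hinj' v₃ hv₃ η hη hPort)

/-- **Crux 19077 (`ShallowEqDeepAtTorsionFree`) on the Kato stratum, CLASS-WIDE, NO inline port**: for
`W ~ W₀` as in `deepUpper_conclusion_classwide_noStub` (datum at the conductor, `hN`),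
`∂^{(∞)}_deep(δ̃) ≤ ∂^{(∞)}(δ̃)` at `W`, GRANTED [S24] (1)(2), GZK, Poitou–Tate and PORT″ — kim3's
`shallowEqDeep_conclusion_classwide_of_ports_of_deepUpper` with `hU` produced.
[cite: Kim2025RefinedTNC, Thm 1.1] [cite: Sakamoto2024, Thm. 4.4 (p. 926)] [cite: MilneADT2006, Ch. I, Thm. 4.10] -/
theorem shallowEqDeep_conclusion_classwide_noStub
    (hS24 : Sakamoto2024.kolyvaginSystems_freeRankOne_zmod_three_pow)
    (hS24₂ : Sakamoto2024.kolyvaginSystems_idealOfBasis_eq_fittingIdeal_zmod_three_pow)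
    (hGZK : rank_eq_analyticRank_of_analyticRank_le_one)
    (hPT : poitouTate_selmerStructure_duality ℚ)
    (W W₀ : WeierstrassCurve ℚ) [W.IsElliptic] [W.IsGloballyMinimal] [W₀.IsElliptic]
    [W₀.IsGloballyMinimal] (hiso : IsIsogenous W W₀)
    (hadd : haveI : Fact (Nat.Prime 3) := ⟨Nat.prime_three⟩; Addv W 3)
    (htower : ∀ m : ℕ, W.HasSurjectiveModNGaloisRep (3 ^ m : ℕ))
    (ht0 : Nat.card {Q : (W.baseChange ℚ_[3]).toAffine.Point // (3 : ℕ) • Q = 0} = 1)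
    (hc3 : ¬ 3 ∣ (W₀.baseChange ℚ_[3]).localTamagawaNumber ℤ_[3])
    {N : ℕ} [NeZero N] (hN : N = W₀.conductorNorm ℤ) (D₀ : ModularParametrizationData W₀ N)
    (hopt : ∀ z ∈ D₀.L.lattice, ∃ w ∈ periodLattice D₀.f, z = D₀.c * w)
    (hcD : ¬ (3 : ℤ) ∣ D₀.maninConstant)
    (hint : ∀ r : ℚ, ratPlusSymbol D₀.f r ≠ 0 → 0 ≤ padicValRat 3 (ratPlusSymbol D₀.f r))
    (v₃ : HeightOneSpectrum (𝓞 ℚ)) (hv₃ : ((3 : ℕ) : 𝓞 ℚ) ∈ v₃.asIdeal)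
    (η : (q : HeightOneSpectrum (𝓞 ℚ)) → (ZMod (Ideal.absNorm q.asIdeal))ˣ)
    (hη : ∀ q : HeightOneSpectrum (𝓞 ℚ), Subgroup.zpowers (η q) = ⊤)
    (hPort : KatoKuriharaPortThreeAtWith₂ W₀ 0 v₃ η D₀)
    (hord : kuriharaVanishingOrder W 3 D₀.f = 0) :
    kuriharaPartialDeepInfty W 3 D₀.f ≤ kuriharaPartialInfty W 3 D₀.f :=
  shallowEqDeep_conclusion_classwide_of_ports_of_deepUpper hS24 hS24₂ hGZK hPT W W₀ hiso hadd htower ht0 hc3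
    hN D₀ hopt hcD v₃ hv₃ η hη hPort hord
    (deepUpper_conclusion_classwide_noStub hS24 hS24₂ hGZK hPT W W₀ hiso hadd htower ht0 hc3 D₀ hopt hcD
      hint v₃ hv₃ η hη hPort hord)

end Summit.BirchSwinnertonDyer.BirchSwinnertonDyer.Theorems.KimAtThreeShallowEqDeepNoStubCruxes

end
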